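import Literature.MathematicalPhysics.QuantumFieldTheory.Balaban1983to89.Beta.ComposedRoadFromSpec
import Literature.MathematicalPhysics.QuantumFieldTheory.Balaban1983to89.Beta.AveragedAFCarrier

/-!
# Beta / AveragedAFCarrierFromSpec — the [III]-SIDE TWIN of `ComposedRoadFromSpec`: the wall with the (O1′) hypothesis in its final
# type (spec families / an2's minimiser kernels) delivers not only `EndpointExistence` but THE WHOLE LOCATED [III] LIST, all profiles,
# every β₀, below one threshold (β sub-cell, [III]-side CO-LEAD unit `b2b-balaban-strat-b14` gen 14; BETA-SPEC §5.15 (c) / §5.18 / §7.30;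
# v1.1 gen 15: DOCSTRING-ONLY — the CENSUS READING paragraph below, declarations byte-unchanged)

HONEST FRAMING (page 1 of everything the β sub-cell writes): discharging `BetaPertH` makes Bałaban's UV stability UNCONDITIONAL — a
real constructive-QFT result; it is NOT the continuum limit and NOT the Clay problem.  THIS MODULE is CLASS-LEVEL BOOKKEEPING: it
composes two LANDED kernel files — the lead's `ComposedRoadFromSpec` v1 (p184095; wall binders with `hid` replaced by b12's
`identityForm_of_specFamilies'` / an2's `identityForm_of_minimiserFamilies'`) and this lineage's `AveragedAFCarrier` v1.7 (p183315;
`wallEND_of_composedLegInterfacePow_identity_avg_remainderConst_allProfiles`) — and asserts nothing printed by Bałaban; every statement is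
[folklore] bookkeeping over the cell's hypothesis carriers.  EVERY β-binder is uninstantiated for Bałaban's objects; the wall
(BETA-SPEC §7.20 (T) / §7.30) is UNTOUCHED; road-(1) verdict unchanged (PRECISELY WALLED at END-STATEMENT grade; nothing of (M2⁺)
discharged); value = census precision, NOT summit progress.

CENSUS READING (v1.1; RULING (R16-1)/(R16-2), BETA-SPEC §7.31; beta-ref C-beta-167 / A-R290 / A-R298, `BETA/WALL.md` v1.6 §3–§4):
among the binders of the four END theorems below, the Hessian data (`T`, `hTA`, `hT0`/`hT1` resp. `hdiv`/`hinv`), the read-out `F`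
and `hβ` are FREE — inhabited for EVERY `β⁰` (beta-ref's dipole-kernel witness `HessianWitness.lean`, `F = M₀₀₀₀/2`; lit3-g14's
`symm_block_inhabited` for the symmetric variant), hence NOT debts and no seat is to be staffed on them; the spec-family data
(`Nf`, `S`, `w`, `hwA`, `hrep`) of the two `specFamilies` forms are SUPPLIED in the tree (an2 `KernelSpecInstance.specK`, `specK_H` by
`rfl`; the two `minimiser` forms carry none) — RULING (R16-1): (D2)/(O1′) struck, closed by re-parametrisation, nothing owed, never
load-bearing at END-STATEMENT grade.  The DEBT carried by these theorems is EXACTLY: (D1) `hident` — at these binders it is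
`hident_avg` at `μC := fun j _ => Sβ.β0 j` in Hessian clothing (`hβ` + exact telescoping: the `IdentityForm` produced by
`identityForm_of_specFamilies'` / `identityForm_of_minimiserFamilies'` says `composedCoeff μC m = Σ_{j<m} β⁰_j`; lit3-g14 kernel pins
`sec2_of_trivial` / `trivial_of_sec2`, C-lit3g14-1 and C-lit3g14-1a) —,
(D3) the per-base-point leg binders `hF hG hFtail hGtail`, (D4) `hrem`/`hr` (`RemainderConst`, `rr < stepBal N Lc`), (D5) `hcont`/`hup`
(+ `hgen` and the [III] run-side data, structural).  The census form with (D1) LITERAL and no free parameters at all is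
`AveragedAFCarrierScalewise.wallEND_trivial_avg_remainderConst_allProfiles` (gen 15).

ABSOLUTE RULE (cell charter, verbatim): "No internally-minted statement may enter as a cited fact. Every hypothesis is either
kernel-proved in this package or a verbatim quotation of a PUBLISHED theorem with page reference. The manuscript(s) under audit are
NOT citable for their own disputed steps — they are the thing under adjudication; programme-internal (2001/route/tribunal) claims
are never citable."

READING CLAUSE (W-KKT-2): as in `ComposedRoadFromSpec` (header) — «minimiser kernel» means the solution operator of the TYPED U = 1
block-averaging KKT system `AffineReproduction.InfiniteVolumeSpec`; its identification with Bałaban's U = 1 gauge-fixed linearised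
minimiser ([Balaban1987RG1] p. 264 (1.20); [Balaban1985BackgroundPropagators] (3.21)–(3.26); [Balaban1984PropagatorsI] p. 26
(1.48)–(1.49)) is NOT asserted by any theorem here.

## What (four END theorems, each a ONE-LINE composition)

For each END theorem `ComposedRoadFromSpec.endpointExistence_of_composedLegInterfacePow_{specFamilies|minimiser}_avg_remainderConst[_of_symmetries]`
(conclusion `EndpointExistence Cn`, remainder clause `rr ≤ stepBal N Lc`) the [III]-side twin
`wallEND_of_composedLegInterfacePow_{…}_allProfiles` takes THE SAME binders with the remainder clause STRICT (`rr < stepBal N Lc` — the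
[III] list needs positive slope: `ConstRemainderConsumers.Margin.sum246_fails` at equality) plus the run-side data of the [III] consumers
(`HaltsOutside`, `CurriesHBeta`, `0 < β₀`, `L ≥ 2`, a maximal profile exponent `p`, `κ₀ ≥ 6`) and concludes
`EndpointExistence Cn ∧ ∃ γ₁ > 0, ∀ γ ≤ min γ₀ γ₁, ∀ runs in ]0,γ], ∀ p′ ≤ p, ∀ A₀ ≥ 0: sizes (2.28)/(2.31) ∧ HorizonFacts` ((2.6)–(2.9) +
(2.46) of [Balaban1988Convergent] pp. 255–263) — by `AveragedAFCarrier.wallEND_of_composedLegInterfacePow_identity_avg_remainderConst_allProfiles`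
with `hid` supplied exactly as in `ComposedRoadFromSpec`.  Source located: [Balaban1987RG1, Thm 2 p.259, Thm 3 p.264];
[Balaban1988Convergent, (2.5)–(2.9) pp.255–256, (2.28) p.259, (2.46) p.263] (quoted verbatim in `B14FlowStep` / `AveragedAFCarrier`).
-/

namespace Literature.MathematicalPhysics.QuantumFieldTheory.Balaban1983to89.Beta.AveragedAFCarrierFromSpec

open Finset
open Literature.Probability.LatticeModels (annulus)
open Literature.MathematicalPhysics.QuantumFieldTheory.Balaban1983to89
open FlowStep FlowStepRuns DagBinding B14DeltaBeta
open Literature.MathematicalPhysics.QuantumFieldTheory.Balaban1983to89.Beta.TransverseStructure (E4)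
open Literature.MathematicalPhysics.QuantumFieldTheory.Balaban1983to89.Beta.LeadingCoefficient (leadingIntegrand kappaBal transverseValue)
open Literature.MathematicalPhysics.QuantumFieldTheory.Balaban1983to89.Beta.DyadicShell (Pt toReal supNorm)
open Literature.MathematicalPhysics.QuantumFieldTheory.Balaban1983to89.Beta.BubbleTransfer (Leg contBubble bubbleConst)
open Literature.MathematicalPhysics.QuantumFieldTheory.Balaban1983to89.Beta.Drift (OneLoopDrift)
open Literature.MathematicalPhysics.QuantumFieldTheory.Balaban1983to89.Beta.RemainderChain (RemainderConst)
open Literature.MathematicalPhysics.QuantumFieldTheory.Balaban1983to89.Beta.MarginalTelescoping (composedCoeff IdentityForm)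
open Literature.MathematicalPhysics.QuantumFieldTheory.Balaban1983to89.Beta.LargeLWindow.WindowDecomposition (constA)
open AffineReproduction (InfiniteVolumeSpec)
open DecimatedMomentSummable (AbsMoment₂)
open DressedMomentNormalisation (EKer coarseTensor m2Tensor)
open KernelRepresentationSummable (kernelOpSum)
open KernelSpecIdentityForm (DivFree MidInv identityForm_of_specFamilies' identityForm_of_specFamilies_of_symmetries)
open MinimiserIdentityForm (wK identityForm_of_minimiserFamilies' identityForm_of_minimiserFamilies_of_symmetries)
open ComposedRoad AveragedAFCarrier

variable {ι : Type*} {s : Finset ι} {cc₀ : ι → ℝ} {P Q : ι → Leg} {κB : Type*}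

/-- **THE WALL FROM SPEC FAMILIES, [III] SIDE, ALL PROFILES.**  The binders of
`ComposedRoadFromSpec.endpointExistence_of_composedLegInterfacePow_specFamilies_avg_remainderConst` verbatim — §10 averaged leg binders
with `μC j k := F (coarseTensor (Nf j k) (w j k) (T j))`, the spec-family data `(Nf, S, w, hwA, hrep)`, the Hessian data
`(T, hTA, hT0, hT1)`, the read-out `F`, `hβ`, `hident`, `RemainderConst`, (C), the printed-type upper bound — with the remainder clause
STRICT (`rr < stepBal N Lc`) and the [III] run-side data ⟹ `EndpointExistence Cn` ∧ the located [III] list for all profile exponents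
`p′ ≤ p` and amplitudes `A₀ ≥ 0`, every `β₀ > 0`, below one threshold.  (`hid` := b12's `identityForm_of_specFamilies'`.)
[cite: Balaban1987RG1, Thm 2 p.259 and Thm 3 p.264] [cite: Balaban1988Convergent, (2.5)–(2.9) pp.255–256, (2.28) p.259, (2.46) p.263] -/
theorem wallEND_of_composedLegInterfacePow_specFamilies_avg_remainderConst_allProfiles {β : HBeta} {Cn : B12.Construction}
    (hgen : ForwardGenerated Cn β) (hhalt : HaltsOutside Cn β) (hcur : CurriesHBeta Cn β)
    (Sβ : B12Beta.OneLoopSplit β)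
    (hdeg : ∀ i ∈ s, (P i).a + (Q i).a = 6) {μ ν : Fin 4} (hμν : μ ≠ ν) {N : ℝ} (hN : N ≠ 0)
    (hval : ∀ x : E4, x ≠ 0 → x μ * x ν * contBubble s cc₀ P Q x = leadingIntegrand (kappaBal N) μ ν x)
    {Lc : ℕ} (hL : 2 ≤ Lc)
    (Nf : ℕ → ℕ → ℕ) (hNf : ∀ j k, j < k → Nf j k ≠ 0)
    (S : ∀ j k : ℕ, j < k → InfiniteVolumeSpec 4 (Nf j k)) (w : ℕ → ℕ → EKer 4) (T : ℕ → EKer 4)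
    (hwA : ∀ j k, j < k → ∀ κ l, AbsMoment₂ (w j k κ l))
    (hrep : ∀ j k (hjk : j < k), (S j k hjk).H = kernelOpSum (Nf j k) (w j k))
    (hTA : ∀ j c e, AbsMoment₂ (T j c e)) (hT0 : ∀ j c e, HasSum (T j c e) 0)
    (hT1 : ∀ j c e (ρ : Fin 4), HasSum (fun t : Fin 4 → ℤ => t ρ • T j c e t) 0)
    (F : (Fin 4 → Fin 4 → Fin 4 → Fin 4 → ℝ) → ℝ) (hβ : ∀ j, Sβ.β0 j = F (m2Tensor (T j)))
    {F' G' : κB → ι → ℕ → Pt → ℝ} {R Sg R' S' : ι → ℝ} {δ U cc : ℝ} {M : ℕ → ℕ}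
    {Bset : ℕ → Finset κB} {wt : ℕ → κB → ℝ}
    (hwt0 : ∀ n : ℕ, 2 ≤ n → ∀ b ∈ Bset n, 0 ≤ wt n b) (hwt1 : ∀ n : ℕ, 2 ≤ n → ∑ b ∈ Bset n, wt n b = 1)
    (hR : ∀ i ∈ s, 0 ≤ R i) (hS : ∀ i ∈ s, 0 ≤ Sg i) (hR' : ∀ i ∈ s, 0 ≤ R' i) (hS' : ∀ i ∈ s, 0 ≤ S' i) (hδ : 0 < δ)
    (hc : 1 ≤ cc) (hM : ∀ L : ℕ, 2 ≤ L → 1 ≤ M L ∧ (L : ℝ) ≤ cc * M L) (hML : ∀ L : ℕ, 2 ≤ L → M L ≤ L)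
    (hF : ∀ m : ℕ, 1 ≤ m → ∀ b ∈ Bset (Lc ^ m), ∀ w' ∈ annulus 4 0 (M (Lc ^ m)), ∀ i ∈ s,
      |F' b i (Lc ^ m) w' - (P i).f (Lc ^ m) 0 w'| ≤ R i / ((supNorm w' : ℝ) ^ ((P i).a - 2) * ((Lc ^ m : ℕ) : ℝ) ^ 2))
    (hG : ∀ m : ℕ, 1 ≤ m → ∀ b ∈ Bset (Lc ^ m), ∀ w' ∈ annulus 4 0 (M (Lc ^ m)), ∀ i ∈ s,
      |G' b i (Lc ^ m) w' - (Q i).f (Lc ^ m) 0 w'| ≤ Sg i / ((supNorm w' : ℝ) ^ ((Q i).a - 2) * ((Lc ^ m : ℕ) : ℝ) ^ 2))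
    (hFtail : ∀ m : ℕ, 1 ≤ m → ∀ b ∈ Bset (Lc ^ m), ∀ r : ℕ, M (Lc ^ m) ≤ r → ∀ w' ∈ annulus 4 r (r + 1), ∀ i ∈ s,
      |F' b i (Lc ^ m) w'| ≤ R' i / ((r : ℝ) + 1) ^ (P i).a * Real.exp (-(δ / ((Lc ^ m : ℕ) : ℝ)) * ((r : ℝ) + 1)))
    (hGtail : ∀ m : ℕ, 1 ≤ m → ∀ b ∈ Bset (Lc ^ m), ∀ r : ℕ, M (Lc ^ m) ≤ r → ∀ w' ∈ annulus 4 r (r + 1), ∀ i ∈ s,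
      |G' b i (Lc ^ m) w'| ≤ S' i / ((r : ℝ) + 1) ^ (Q i).a)
    (hident : ∀ m : ℕ, 1 ≤ m → ∃ R₀ : ℕ, M (Lc ^ m) ≤ R₀ ∧
      |composedCoeff (fun j k => F (coarseTensor (Nf j k) (w j k) (T j))) m
        - ∑ b ∈ Bset (Lc ^ m), wt (Lc ^ m) b * ∑ w' ∈ annulus 4 0 R₀, toReal w' μ * toReal w' ν *
          ∑ i ∈ s, cc₀ i * (F' b i (Lc ^ m) w' * G' b i (Lc ^ m) w')| ≤ U)
    {rr γ₀ β' β₀ : ℝ} (hγ₀ : 0 < γ₀) (hrem : RemainderConst Sβ γ₀ rr) (hr : rr < B12Normalization.stepBal N Lc)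
    (hcont : BetaContH γ₀ β) (hup : BetaUpperH β' γ₀ β) (hβ' : 0 ≤ β') (hβ₀ : 0 < β₀)
    {L : ℕ} (hL2 : 2 ≤ L) (p : ℕ) {κ₀ : ℕ} (hκ : 6 ≤ κ₀) :
    EndpointExistence Cn ∧ ∃ γ₁ : ℝ, 0 < γ₁ ∧
      ∀ γ : ℝ, 0 < γ → γ ≤ min γ₀ γ₁ → ∀ Pr : B12.RunParams, (Cn Pr).flow.InInterval γ Pr.K →
        ∀ p' : ℕ, p' ≤ p → ∀ A₀ : ℝ, 0 ≤ A₀ →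
          ∃ Rj : ℕ → ℕ, (∀ j, B14.IsRj L p' ((Cn Pr).flow.g j) (Rj j)) ∧
            HorizonFacts (Cn Pr).flow β' β₀ A₀ L p' κ₀ Rj Pr.K :=
  wallEND_of_composedLegInterfacePow_identity_avg_remainderConst_allProfiles hgen hhalt hcur Sβ hdeg hμν hN hval hL hwt0 hwt1
    hR hS hR' hS' hδ hc hM hML hF hG hFtail hGtail hident
    (identityForm_of_specFamilies' Nf hNf S w T hwA hrep hTA hT0 hT1 F hβ)
    hγ₀ hrem hr hcont hup hβ' hβ₀ hL2 p hκ

/-- **… with (T0)/(T1) from the two symmetries of the Hessian kernels** (`DivFree`, `MidInv`; b12's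
`identityForm_of_specFamilies_of_symmetries`), [III] side, all profiles. [cite: Balaban1988Convergent, (2.5)–(2.9) pp.255–256 and (2.46) p.263] -/
theorem wallEND_of_composedLegInterfacePow_specFamilies_avg_remainderConst_of_symmetries_allProfiles {β : HBeta} {Cn : B12.Construction}
    (hgen : ForwardGenerated Cn β) (hhalt : HaltsOutside Cn β) (hcur : CurriesHBeta Cn β)
    (Sβ : B12Beta.OneLoopSplit β)
    (hdeg : ∀ i ∈ s, (P i).a + (Q i).a = 6) {μ ν : Fin 4} (hμν : μ ≠ ν) {N : ℝ} (hN : N ≠ 0)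
    (hval : ∀ x : E4, x ≠ 0 → x μ * x ν * contBubble s cc₀ P Q x = leadingIntegrand (kappaBal N) μ ν x)
    {Lc : ℕ} (hL : 2 ≤ Lc)
    (Nf : ℕ → ℕ → ℕ) (hNf : ∀ j k, j < k → Nf j k ≠ 0)
    (S : ∀ j k : ℕ, j < k → InfiniteVolumeSpec 4 (Nf j k)) (w : ℕ → ℕ → EKer 4) (T : ℕ → EKer 4)
    (hwA : ∀ j k, j < k → ∀ κ l, AbsMoment₂ (w j k κ l))
    (hrep : ∀ j k (hjk : j < k), (S j k hjk).H = kernelOpSum (Nf j k) (w j k))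
    (hTA : ∀ j c e, AbsMoment₂ (T j c e)) (hdiv : ∀ j, DivFree (T j)) (hinv : ∀ j, MidInv (T j))
    (F : (Fin 4 → Fin 4 → Fin 4 → Fin 4 → ℝ) → ℝ) (hβ : ∀ j, Sβ.β0 j = F (m2Tensor (T j)))
    {F' G' : κB → ι → ℕ → Pt → ℝ} {R Sg R' S' : ι → ℝ} {δ U cc : ℝ} {M : ℕ → ℕ}
    {Bset : ℕ → Finset κB} {wt : ℕ → κB → ℝ}
    (hwt0 : ∀ n : ℕ, 2 ≤ n → ∀ b ∈ Bset n, 0 ≤ wt n b) (hwt1 : ∀ n : ℕ, 2 ≤ n → ∑ b ∈ Bset n, wt n b = 1)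
    (hR : ∀ i ∈ s, 0 ≤ R i) (hS : ∀ i ∈ s, 0 ≤ Sg i) (hR' : ∀ i ∈ s, 0 ≤ R' i) (hS' : ∀ i ∈ s, 0 ≤ S' i) (hδ : 0 < δ)
    (hc : 1 ≤ cc) (hM : ∀ L : ℕ, 2 ≤ L → 1 ≤ M L ∧ (L : ℝ) ≤ cc * M L) (hML : ∀ L : ℕ, 2 ≤ L → M L ≤ L)
    (hF : ∀ m : ℕ, 1 ≤ m → ∀ b ∈ Bset (Lc ^ m), ∀ w' ∈ annulus 4 0 (M (Lc ^ m)), ∀ i ∈ s,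
      |F' b i (Lc ^ m) w' - (P i).f (Lc ^ m) 0 w'| ≤ R i / ((supNorm w' : ℝ) ^ ((P i).a - 2) * ((Lc ^ m : ℕ) : ℝ) ^ 2))
    (hG : ∀ m : ℕ, 1 ≤ m → ∀ b ∈ Bset (Lc ^ m), ∀ w' ∈ annulus 4 0 (M (Lc ^ m)), ∀ i ∈ s,
      |G' b i (Lc ^ m) w' - (Q i).f (Lc ^ m) 0 w'| ≤ Sg i / ((supNorm w' : ℝ) ^ ((Q i).a - 2) * ((Lc ^ m : ℕ) : ℝ) ^ 2))
    (hFtail : ∀ m : ℕ, 1 ≤ m → ∀ b ∈ Bset (Lc ^ m), ∀ r : ℕ, M (Lc ^ m) ≤ r → ∀ w' ∈ annulus 4 r (r + 1), ∀ i ∈ s,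
      |F' b i (Lc ^ m) w'| ≤ R' i / ((r : ℝ) + 1) ^ (P i).a * Real.exp (-(δ / ((Lc ^ m : ℕ) : ℝ)) * ((r : ℝ) + 1)))
    (hGtail : ∀ m : ℕ, 1 ≤ m → ∀ b ∈ Bset (Lc ^ m), ∀ r : ℕ, M (Lc ^ m) ≤ r → ∀ w' ∈ annulus 4 r (r + 1), ∀ i ∈ s,
      |G' b i (Lc ^ m) w'| ≤ S' i / ((r : ℝ) + 1) ^ (Q i).a)
    (hident : ∀ m : ℕ, 1 ≤ m → ∃ R₀ : ℕ, M (Lc ^ m) ≤ R₀ ∧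
      |composedCoeff (fun j k => F (coarseTensor (Nf j k) (w j k) (T j))) m
        - ∑ b ∈ Bset (Lc ^ m), wt (Lc ^ m) b * ∑ w' ∈ annulus 4 0 R₀, toReal w' μ * toReal w' ν *
          ∑ i ∈ s, cc₀ i * (F' b i (Lc ^ m) w' * G' b i (Lc ^ m) w')| ≤ U)
    {rr γ₀ β' β₀ : ℝ} (hγ₀ : 0 < γ₀) (hrem : RemainderConst Sβ γ₀ rr) (hr : rr < B12Normalization.stepBal N Lc)
    (hcont : BetaContH γ₀ β) (hup : BetaUpperH β' γ₀ β) (hβ' : 0 ≤ β') (hβ₀ : 0 < β₀)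
    {L : ℕ} (hL2 : 2 ≤ L) (p : ℕ) {κ₀ : ℕ} (hκ : 6 ≤ κ₀) :
    EndpointExistence Cn ∧ ∃ γ₁ : ℝ, 0 < γ₁ ∧
      ∀ γ : ℝ, 0 < γ → γ ≤ min γ₀ γ₁ → ∀ Pr : B12.RunParams, (Cn Pr).flow.InInterval γ Pr.K →
        ∀ p' : ℕ, p' ≤ p → ∀ A₀ : ℝ, 0 ≤ A₀ →
          ∃ Rj : ℕ → ℕ, (∀ j, B14.IsRj L p' ((Cn Pr).flow.g j) (Rj j)) ∧
            HorizonFacts (Cn Pr).flow β' β₀ A₀ L p' κ₀ Rj Pr.K :=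
  wallEND_of_composedLegInterfacePow_identity_avg_remainderConst_allProfiles hgen hhalt hcur Sβ hdeg hμν hN hval hL hwt0 hwt1
    hR hS hR' hS' hδ hc hM hML hF hG hFtail hGtail hident
    (by
      have h := identityForm_of_specFamilies_of_symmetries Nf hNf S w T hwA hrep hTA hdiv hinv F
      intro j k hjk
      rw [hβ j]
      exact h j k hjk)
    hγ₀ hrem hr hcont hup hβ' hβ₀ hL2 p hκ

/-- **THE WALL FOR THE TYPED SYSTEM'S OWN SOLUTION-OPERATOR KERNELS `wK (Lc^(k−j))`, [III] SIDE, ALL PROFILES** — zero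
minimiser-side binders (an2's `identityForm_of_minimiserFamilies'`): ONLY the §10 leg binders, the Hessian kernels `T j` with
`AbsMoment₂` and (T0)/(T1), the read-out `F`, `hβ`, `hident` for `μC j k := F (coarseTensor (Lc^(k−j)) (wK (Lc^(k−j))) (T j))`, the downstream
binders (remainder clause STRICT) and the [III] run-side data.  Subject to the READING CLAUSE (W-KKT-2).
[cite: Balaban1987RG1, Thm 2 p.259 and Thm 3 p.264] [cite: Balaban1988Convergent, (2.5)–(2.9) pp.255–256, (2.28) p.259, (2.46) p.263] -/
theorem wallEND_of_composedLegInterfacePow_minimiser_avg_remainderConst_allProfiles {β : HBeta} {Cn : B12.Construction}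
    (hgen : ForwardGenerated Cn β) (hhalt : HaltsOutside Cn β) (hcur : CurriesHBeta Cn β)
    (Sβ : B12Beta.OneLoopSplit β)
    (hdeg : ∀ i ∈ s, (P i).a + (Q i).a = 6) {μ ν : Fin 4} (hμν : μ ≠ ν) {N : ℝ} (hN : N ≠ 0)
    (hval : ∀ x : E4, x ≠ 0 → x μ * x ν * contBubble s cc₀ P Q x = leadingIntegrand (kappaBal N) μ ν x)
    {Lc : ℕ} [NeZero Lc] (hL : 2 ≤ Lc) (T : ℕ → EKer 4)
    (hTA : ∀ j c e, AbsMoment₂ (T j c e)) (hT0 : ∀ j c e, HasSum (T j c e) 0)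
    (hT1 : ∀ j c e (ρ : Fin 4), HasSum (fun t : Fin 4 → ℤ => t ρ • T j c e t) 0)
    (F : (Fin 4 → Fin 4 → Fin 4 → Fin 4 → ℝ) → ℝ) (hβ : ∀ j, Sβ.β0 j = F (m2Tensor (T j)))
    {F' G' : κB → ι → ℕ → Pt → ℝ} {R Sg R' S' : ι → ℝ} {δ U cc : ℝ} {M : ℕ → ℕ}
    {Bset : ℕ → Finset κB} {wt : ℕ → κB → ℝ}
    (hwt0 : ∀ n : ℕ, 2 ≤ n → ∀ b ∈ Bset n, 0 ≤ wt n b) (hwt1 : ∀ n : ℕ, 2 ≤ n → ∑ b ∈ Bset n, wt n b = 1)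
    (hR : ∀ i ∈ s, 0 ≤ R i) (hS : ∀ i ∈ s, 0 ≤ Sg i) (hR' : ∀ i ∈ s, 0 ≤ R' i) (hS' : ∀ i ∈ s, 0 ≤ S' i) (hδ : 0 < δ)
    (hc : 1 ≤ cc) (hM : ∀ L : ℕ, 2 ≤ L → 1 ≤ M L ∧ (L : ℝ) ≤ cc * M L) (hML : ∀ L : ℕ, 2 ≤ L → M L ≤ L)
    (hF : ∀ m : ℕ, 1 ≤ m → ∀ b ∈ Bset (Lc ^ m), ∀ w' ∈ annulus 4 0 (M (Lc ^ m)), ∀ i ∈ s,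
      |F' b i (Lc ^ m) w' - (P i).f (Lc ^ m) 0 w'| ≤ R i / ((supNorm w' : ℝ) ^ ((P i).a - 2) * ((Lc ^ m : ℕ) : ℝ) ^ 2))
    (hG : ∀ m : ℕ, 1 ≤ m → ∀ b ∈ Bset (Lc ^ m), ∀ w' ∈ annulus 4 0 (M (Lc ^ m)), ∀ i ∈ s,
      |G' b i (Lc ^ m) w' - (Q i).f (Lc ^ m) 0 w'| ≤ Sg i / ((supNorm w' : ℝ) ^ ((Q i).a - 2) * ((Lc ^ m : ℕ) : ℝ) ^ 2))
    (hFtail : ∀ m : ℕ, 1 ≤ m → ∀ b ∈ Bset (Lc ^ m), ∀ r : ℕ, M (Lc ^ m) ≤ r → ∀ w' ∈ annulus 4 r (r + 1), ∀ i ∈ s,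
      |F' b i (Lc ^ m) w'| ≤ R' i / ((r : ℝ) + 1) ^ (P i).a * Real.exp (-(δ / ((Lc ^ m : ℕ) : ℝ)) * ((r : ℝ) + 1)))
    (hGtail : ∀ m : ℕ, 1 ≤ m → ∀ b ∈ Bset (Lc ^ m), ∀ r : ℕ, M (Lc ^ m) ≤ r → ∀ w' ∈ annulus 4 r (r + 1), ∀ i ∈ s,
      |G' b i (Lc ^ m) w'| ≤ S' i / ((r : ℝ) + 1) ^ (Q i).a)
    (hident : ∀ m : ℕ, 1 ≤ m → ∃ R₀ : ℕ, M (Lc ^ m) ≤ R₀ ∧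
      |composedCoeff (fun j k => F (coarseTensor (Lc ^ (k - j)) (wK (Lc ^ (k - j))) (T j))) m
        - ∑ b ∈ Bset (Lc ^ m), wt (Lc ^ m) b * ∑ w' ∈ annulus 4 0 R₀, toReal w' μ * toReal w' ν *
          ∑ i ∈ s, cc₀ i * (F' b i (Lc ^ m) w' * G' b i (Lc ^ m) w')| ≤ U)
    {rr γ₀ β' β₀ : ℝ} (hγ₀ : 0 < γ₀) (hrem : RemainderConst Sβ γ₀ rr) (hr : rr < B12Normalization.stepBal N Lc)
    (hcont : BetaContH γ₀ β) (hup : BetaUpperH β' γ₀ β) (hβ' : 0 ≤ β') (hβ₀ : 0 < β₀)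
    {L : ℕ} (hL2 : 2 ≤ L) (p : ℕ) {κ₀ : ℕ} (hκ : 6 ≤ κ₀) :
    EndpointExistence Cn ∧ ∃ γ₁ : ℝ, 0 < γ₁ ∧
      ∀ γ : ℝ, 0 < γ → γ ≤ min γ₀ γ₁ → ∀ Pr : B12.RunParams, (Cn Pr).flow.InInterval γ Pr.K →
        ∀ p' : ℕ, p' ≤ p → ∀ A₀ : ℝ, 0 ≤ A₀ →
          ∃ Rj : ℕ → ℕ, (∀ j, B14.IsRj L p' ((Cn Pr).flow.g j) (Rj j)) ∧
            HorizonFacts (Cn Pr).flow β' β₀ A₀ L p' κ₀ Rj Pr.K :=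
  wallEND_of_composedLegInterfacePow_identity_avg_remainderConst_allProfiles hgen hhalt hcur Sβ hdeg hμν hN hval hL hwt0 hwt1
    hR hS hR' hS' hδ hc hM hML hF hG hFtail hGtail hident
    (identityForm_of_minimiserFamilies' (fun j k => Lc ^ (k - j)) T hTA hT0 hT1 F hβ)
    hγ₀ hrem hr hcont hup hβ' hβ₀ hL2 p hκ

/-- **… with (T0)/(T1) from the two symmetries of the Hessian kernels in an2's explicit form**
(`identityForm_of_minimiserFamilies_of_symmetries`), [III] side, all profiles.  Subject to the READING CLAUSE (W-KKT-2).
[cite: Balaban1988Convergent, (2.5)–(2.9) pp.255–256 and (2.46) p.263] -/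
theorem wallEND_of_composedLegInterfacePow_minimiser_avg_remainderConst_of_symmetries_allProfiles {β : HBeta}
    {Cn : B12.Construction} (hgen : ForwardGenerated Cn β) (hhalt : HaltsOutside Cn β) (hcur : CurriesHBeta Cn β)
    (Sβ : B12Beta.OneLoopSplit β)
    (hdeg : ∀ i ∈ s, (P i).a + (Q i).a = 6) {μ ν : Fin 4} (hμν : μ ≠ ν) {N : ℝ} (hN : N ≠ 0)
    (hval : ∀ x : E4, x ≠ 0 → x μ * x ν * contBubble s cc₀ P Q x = leadingIntegrand (kappaBal N) μ ν x)
    {Lc : ℕ} [NeZero Lc] (hL : 2 ≤ Lc) (T : ℕ → EKer 4) (hTA : ∀ j c e, AbsMoment₂ (T j c e))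
    (hdiv : ∀ j (ν' : Fin 4) (x : Fin 4 → ℤ), ∑ μ', (T j μ' ν' x - T j μ' ν' (x - Pi.single μ' 1)) = 0)
    (hinv : ∀ j (μ' ν' : Fin 4) (y : Fin 4 → ℤ), T j μ' ν' ((Pi.single ν' 1 - Pi.single μ' 1) - y) = T j μ' ν' y)
    (F : (Fin 4 → Fin 4 → Fin 4 → Fin 4 → ℝ) → ℝ) (hβ : ∀ j, Sβ.β0 j = F (m2Tensor (T j)))
    {F' G' : κB → ι → ℕ → Pt → ℝ} {R Sg R' S' : ι → ℝ} {δ U cc : ℝ} {M : ℕ → ℕ}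
    {Bset : ℕ → Finset κB} {wt : ℕ → κB → ℝ}
    (hwt0 : ∀ n : ℕ, 2 ≤ n → ∀ b ∈ Bset n, 0 ≤ wt n b) (hwt1 : ∀ n : ℕ, 2 ≤ n → ∑ b ∈ Bset n, wt n b = 1)
    (hR : ∀ i ∈ s, 0 ≤ R i) (hS : ∀ i ∈ s, 0 ≤ Sg i) (hR' : ∀ i ∈ s, 0 ≤ R' i) (hS' : ∀ i ∈ s, 0 ≤ S' i) (hδ : 0 < δ)
    (hc : 1 ≤ cc) (hM : ∀ L : ℕ, 2 ≤ L → 1 ≤ M L ∧ (L : ℝ) ≤ cc * M L) (hML : ∀ L : ℕ, 2 ≤ L → M L ≤ L)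
    (hF : ∀ m : ℕ, 1 ≤ m → ∀ b ∈ Bset (Lc ^ m), ∀ w' ∈ annulus 4 0 (M (Lc ^ m)), ∀ i ∈ s,
      |F' b i (Lc ^ m) w' - (P i).f (Lc ^ m) 0 w'| ≤ R i / ((supNorm w' : ℝ) ^ ((P i).a - 2) * ((Lc ^ m : ℕ) : ℝ) ^ 2))
    (hG : ∀ m : ℕ, 1 ≤ m → ∀ b ∈ Bset (Lc ^ m), ∀ w' ∈ annulus 4 0 (M (Lc ^ m)), ∀ i ∈ s,
      |G' b i (Lc ^ m) w' - (Q i).f (Lc ^ m) 0 w'| ≤ Sg i / ((supNorm w' : ℝ) ^ ((Q i).a - 2) * ((Lc ^ m : ℕ) : ℝ) ^ 2))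
    (hFtail : ∀ m : ℕ, 1 ≤ m → ∀ b ∈ Bset (Lc ^ m), ∀ r : ℕ, M (Lc ^ m) ≤ r → ∀ w' ∈ annulus 4 r (r + 1), ∀ i ∈ s,
      |F' b i (Lc ^ m) w'| ≤ R' i / ((r : ℝ) + 1) ^ (P i).a * Real.exp (-(δ / ((Lc ^ m : ℕ) : ℝ)) * ((r : ℝ) + 1)))
    (hGtail : ∀ m : ℕ, 1 ≤ m → ∀ b ∈ Bset (Lc ^ m), ∀ r : ℕ, M (Lc ^ m) ≤ r → ∀ w' ∈ annulus 4 r (r + 1), ∀ i ∈ s,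
      |G' b i (Lc ^ m) w'| ≤ S' i / ((r : ℝ) + 1) ^ (Q i).a)
    (hident : ∀ m : ℕ, 1 ≤ m → ∃ R₀ : ℕ, M (Lc ^ m) ≤ R₀ ∧
      |composedCoeff (fun j k => F (coarseTensor (Lc ^ (k - j)) (wK (Lc ^ (k - j))) (T j))) m
        - ∑ b ∈ Bset (Lc ^ m), wt (Lc ^ m) b * ∑ w' ∈ annulus 4 0 R₀, toReal w' μ * toReal w' ν *
          ∑ i ∈ s, cc₀ i * (F' b i (Lc ^ m) w' * G' b i (Lc ^ m) w')| ≤ U)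
    {rr γ₀ β' β₀ : ℝ} (hγ₀ : 0 < γ₀) (hrem : RemainderConst Sβ γ₀ rr) (hr : rr < B12Normalization.stepBal N Lc)
    (hcont : BetaContH γ₀ β) (hup : BetaUpperH β' γ₀ β) (hβ' : 0 ≤ β') (hβ₀ : 0 < β₀)
    {L : ℕ} (hL2 : 2 ≤ L) (p : ℕ) {κ₀ : ℕ} (hκ : 6 ≤ κ₀) :
    EndpointExistence Cn ∧ ∃ γ₁ : ℝ, 0 < γ₁ ∧
      ∀ γ : ℝ, 0 < γ → γ ≤ min γ₀ γ₁ → ∀ Pr : B12.RunParams, (Cn Pr).flow.InInterval γ Pr.K →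
        ∀ p' : ℕ, p' ≤ p → ∀ A₀ : ℝ, 0 ≤ A₀ →
          ∃ Rj : ℕ → ℕ, (∀ j, B14.IsRj L p' ((Cn Pr).flow.g j) (Rj j)) ∧
            HorizonFacts (Cn Pr).flow β' β₀ A₀ L p' κ₀ Rj Pr.K :=
  wallEND_of_composedLegInterfacePow_identity_avg_remainderConst_allProfiles hgen hhalt hcur Sβ hdeg hμν hN hval hL hwt0 hwt1
    hR hS hR' hS' hδ hc hM hML hF hG hFtail hGtail hident
    (by
      have h := identityForm_of_minimiserFamilies_of_symmetries (fun j k => Lc ^ (k - j)) T hTA hdiv hinv F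
      intro j k hjk
      rw [hβ j]
      exact h j k hjk)
    hγ₀ hrem hr hcont hup hβ' hβ₀ hL2 p hκ

end Literature.MathematicalPhysics.QuantumFieldTheory.Balaban1983to89.Beta.AveragedAFCarrierFromSpec
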